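import Summits.QuantumFields.YangMills.Theorems.VirialFluxGapRingHaarIBP
import Summits.QuantumFields.YangMills.Theorems.VirialFluxGapPeriodicSoftnessWindowArithmeticZero
import Summits.QuantumFields.YangMills.Theses.VirialFluxGap
import HarnessLib

/-!
# Route `VirialFluxGap` (YangMills): `PeriodicSoftness` FROM AN EULER FIELD NEAR THE TORON VALLEY (the virial ∕ IBP reduction)

The deciding crux `VirialFluxGap.PeriodicSoftness` (item stmt-QuantumFields-24141, the route's last open leaf) asks for the ONE-SIDED
bound `β⟨F₀⟩_β ≤ 9L⁴ − c` on Laplace windows (✓`RingDeficit.deficitFormZero`).  This file closes it MODULO a β-FREE geometric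
statement about the zero-flux ring deficit `F₀` alone, the hypothesis «EulerField»:

  for all large `L` there is a coefficient field `X = Σ_j φ_j ∂_j` on the ring space (finitely many translation curves `γ_j`,
  `γ_j(0) = 1`, bounded measurable coefficients `φ_j`, differentiable along their own curve with bounded derivative, and the
  derivatives `∂_jF₀`), an error term `0 ≤ E ≤ KL^q` vanishing on the sublevel set `{F₀ < (KL^q)⁻¹}`, and `0 ≤ ε ≤ 1/4` with
  `εL⁴ ≤ c₁/72`, such that POINTWISE
      `X·F₀ ≥ 2(1−ε)F₀ − E`   and   `div X = Σ_j ∂_jφ_j ≤ 18L⁴ − 2c₁`.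

(The intended witness — NOT constructed here — is the WEIGHTED EULER FIELD of the toron valley: weight `½·2` on the `18L⁴ − 9` massive
directions, `¼·2` on the `12` constant modes near the `16` central torons, `0` along the gauge orbit, glued by a decreasing cut-off in
`F₀`; its divergence is `18L⁴ − 3` in both regimes, so any `c₁ < 3/2` is expected.)

* the «EulerField» hypothesis — stated INLINE in the final theorem (no problem-side `def`; its regularity clauses are exactly those of
  ✓`RingIBP.ring_virial_mean_bound`);
* `tail_le` — the window tail: with the thresholds of ✓`stub_windowArithmeticZero` (clause `64(9L⁴+½)²(1 + 2|log t₁| + log β) ≤ βt₁`),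
  `β·KL^q·exp(−βt₁/2 + 150L⁵(1 + log(2/t₁))) ≤ c₁/4` (`t₁ = (KL^q)⁻¹`);
* `mean_le_of_virial` — the elementary algebra `(18L⁴ − 2c₁ + c₁/4)/(2(1−ε)) ⇒ ≤ 9L⁴ − c₁/2`;
* ★★★ `periodicSoftness_of_eulerField : «EulerField» → Theses.VirialFluxGap.PeriodicSoftness` BY NAME, with `c = c₁/2` and the window
  exponent of ✓`stub_windowArithmeticZero K q 1` (✓`RingIBP.ring_virial_mean_bound` + the floor-controlled tail + ✓`deficitFormZero`).

HONEST FRAMING: a REDUCTION; the Euler field (the geometric heart: normal forms of `F₀` along the toron valley incl. its 16 singular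
strata, uniform in `L`) is NOT constructed here; ⟨24141⟩ stays OPEN; no rung / crux / summit statement is proved; the Yang–Mills mass
gap is NOT proved; no summit is proved by a line.  THEOREMS ONLY (0 `def`, 0 `sorry`), standard axioms.  Width seat `ym-line-sfw-p2-w3` g58 (cell ym-idea-1, free hands), `--supports stmt-QuantumFields-24141`.
References: [cite: Griffiths1964]; [cite: Luscher1983, §2]; [cite: CosteEtAl1985]; [cite: MontvayMunster1994, (3.145)].
-/

set_option autoImplicit false

noncomputable section

open MeasureTheory Set Filter Metric
open scoped Topology BigOperators
open Literature.MathematicalPhysics.QuantumFieldTheory hiding SU2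
open Literature.MathematicalPhysics.QuantumLattice

namespace Summit.QuantumFields.YangMills.Theorems.VirialFluxGap.EulerFieldReduction

open Summit.QuantumFields.YangMills.Theorems.FemtoTransferGap
open Summit.QuantumFields.YangMills.Theorems.FemtoTransferGap.TT
open Summit.QuantumFields.YangMills.Theorems.VirialFluxGap.RingDeficit
open Summit.QuantumFields.YangMills.Theorems.VirialFluxGap.RingIBP
open Summit.QuantumFields.YangMills.Theorems.VirialFluxGapPeriodicSoftnessWindow

/-! ## §1 The Euler-field hypothesis

The hypothesis `hE` of `periodicSoftness_of_eulerField` below («EulerField», stated INLINE — no problem-side `def`, pattern of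
✓`VolumeScaling.periodicSoftness_of_volumeScaling`): constants `c₁ > 0`, `K ≥ 1`, `q ≥ 0`, `L₀`, and for every `L ≥ L₀` finitely many
translation curves `γ_j` of the ring group (`γ_j 0 = 1`) with coefficient functions `φ_j` (bounded measurable, differentiable along their
own curve for `|s| < ε₀` with bounded, strongly measurable derivative `Dφ_j`), the derivatives `DF_j` of `F₀` along the curves (bounded,
strongly measurable), an error term `0 ≤ E ≤ KL^q` vanishing on `{F₀ < (KL^q)⁻¹}` and `0 ≤ ε ≤ 1/4` with `εL⁴ ≤ c₁/72`, such that
pointwise `Σ_j φ_j·DF_j 0 ≥ 2(1−ε)F₀ − E` («`X·F₀ ≥ 2(1−ε)F₀`» near the valley) and `Σ_j Dφ_j 0 ≤ 18L⁴ − 2c₁` («`div X ≤ 18L⁴ − 2c₁`»).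
A seat constructing the field states `theorem eulerField : ∃ c₁ : ℝ, 0 < c₁ ∧ …` with this formula verbatim and applies the reduction. -/

/-! ## §2 The window tail -/

/-- `(9Λ⁴ − 3/2 + 2)² ≥ 81Λ⁸` for `Λ ≥ 1`. [folklore] -/
theorem sq_window_ge {Λ : ℝ} (hΛ : 1 ≤ Λ) : 81 * Λ ^ 8 ≤ (9 * Λ ^ 4 - 3 / 2 + 2) ^ 2 := by
  have h4 : 1 ≤ Λ ^ 4 := one_le_pow₀ hΛ
  nlinarith [h4]

/-- ★ **The window tail is small.**  For `β ≥ 2`, `T ≥ 1`, `Λ ≥ 1`, `c₁ > 0` with `log(4/c₁) ≤ Λ⁸` and the logarithmic threshold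
`64(9Λ⁴ − 3/2 + 2)²(1 + 2 log T + log β) ≤ β·T⁻¹` (clause three of ✓`stub_windowArithmeticZero`, `t₁ = T⁻¹`):
`β·(T·exp(−βT⁻¹/2 + 150Λ⁵(1 + log(2/T⁻¹)))) ≤ c₁/4`. [folklore] -/
theorem tail_le {β T Λ c₁ : ℝ} (hβ : 2 ≤ β) (hT : 1 ≤ T) (hΛ : 1 ≤ Λ) (hc₁ : 0 < c₁)
    (hlog : Real.log (4 / c₁) ≤ Λ ^ 8)
    (hwin : 64 * (9 * Λ ^ 4 - 3 / 2 + 2) ^ 2 * (1 + 2 * Real.log T + Real.log β) ≤ β * T⁻¹) :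
    β * (T * Real.exp (-(β * T⁻¹ / 2) + 150 * Λ ^ 5 * (1 + Real.log (2 / T⁻¹)))) ≤ c₁ / 4 := by
  have hβ0 : 0 < β := by linarith
  have hT0 : 0 < T := by linarith
  have hX : 0 ≤ Real.log β := Real.log_nonneg (by linarith)
  have hY : 0 ≤ Real.log T := Real.log_nonneg hT
  have hΛ8 : 1 ≤ Λ ^ 8 := one_le_pow₀ hΛ
  have hΛ58 : Λ ^ 5 ≤ Λ ^ 8 := pow_le_pow_right₀ hΛ (by norm_num)
  have hΛ5 : 0 ≤ Λ ^ 5 := by positivity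
  have h2T : Real.log (2 / T⁻¹) = Real.log 2 + Real.log T := by
    rw [inv_eq_one_div, div_div_eq_mul_div, div_one, Real.log_mul (by norm_num) hT0.ne']
  have hl2 : Real.log 2 < 7 / 10 := by linarith [Real.log_two_lt_d9]
  -- the exponent bound
  have hsq := sq_window_ge hΛ
  have hsum0 : 0 ≤ 1 + 2 * Real.log T + Real.log β := by linarith
  have hhalf : 2592 * Λ ^ 8 * (1 + 2 * Real.log T + Real.log β) ≤ β * T⁻¹ / 2 := by
    have h1 : 32 * (81 * Λ ^ 8) * (1 + 2 * Real.log T + Real.log β) ≤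
        32 * (9 * Λ ^ 4 - 3 / 2 + 2) ^ 2 * (1 + 2 * Real.log T + Real.log β) :=
      mul_le_mul_of_nonneg_right (mul_le_mul_of_nonneg_left hsq (by norm_num)) hsum0
    linarith
  have hA : -(β * T⁻¹ / 2) + 150 * Λ ^ 5 * (1 + Real.log (2 / T⁻¹)) ≤
      -(2592 * Λ ^ 8 * (1 + 2 * Real.log T + Real.log β)) + 255 * Λ ^ 8 + 150 * Λ ^ 8 * Real.log T := by
    rw [h2T]
    have h1 : 150 * Λ ^ 5 * (1 + (Real.log 2 + Real.log T)) ≤ 150 * Λ ^ 8 * (17 / 10 + Real.log T) := by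
      have h2 : 1 + (Real.log 2 + Real.log T) ≤ 17 / 10 + Real.log T := by linarith
      have h3 : 0 ≤ 17 / 10 + Real.log T := by linarith
      calc 150 * Λ ^ 5 * (1 + (Real.log 2 + Real.log T)) ≤ 150 * Λ ^ 5 * (17 / 10 + Real.log T) :=
            mul_le_mul_of_nonneg_left h2 (by positivity)
        _ ≤ 150 * Λ ^ 8 * (17 / 10 + Real.log T) := mul_le_mul_of_nonneg_right (by linarith) h3
    linarith
  have hkey : Real.log β + Real.log T + (-(β * T⁻¹ / 2) + 150 * Λ ^ 5 * (1 + Real.log (2 / T⁻¹))) ≤ -Real.log (4 / c₁) := by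
    have h1 : Real.log β ≤ 2592 * Λ ^ 8 * Real.log β := by nlinarith
    have h2 : Real.log T + 150 * Λ ^ 8 * Real.log T ≤ 5184 * Λ ^ 8 * Real.log T := by nlinarith
    have h3 : 255 * Λ ^ 8 + Λ ^ 8 ≤ 2592 * Λ ^ 8 := by nlinarith
    nlinarith [hA, h1, h2, h3, hlog, mul_nonneg (by norm_num : (0 : ℝ) ≤ 2592) (mul_nonneg (by positivity : (0 : ℝ) ≤ Λ ^ 8) hsum0)]
  -- exponentiate
  have heq : Real.exp (Real.log β + Real.log T + (-(β * T⁻¹ / 2) + 150 * Λ ^ 5 * (1 + Real.log (2 / T⁻¹)))) =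
      β * (T * Real.exp (-(β * T⁻¹ / 2) + 150 * Λ ^ 5 * (1 + Real.log (2 / T⁻¹)))) := by
    rw [Real.exp_add (Real.log β + Real.log T), Real.exp_add (Real.log β), Real.exp_log hβ0, Real.exp_log hT0, mul_assoc]
  rw [← heq]
  calc Real.exp (Real.log β + Real.log T + (-(β * T⁻¹ / 2) + 150 * Λ ^ 5 * (1 + Real.log (2 / T⁻¹))))
      ≤ Real.exp (-Real.log (4 / c₁)) := Real.exp_le_exp.2 hkey
    _ = c₁ / 4 := by rw [Real.exp_neg, Real.exp_log (by positivity), inv_div]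

/-! ## §3 The elementary mean algebra -/

/-- ★ From `2(1−ε)·M ≤ 18L⁴ − 2c₁ + τ` with `τ ≤ c₁/4`, `0 ≤ M`, `0 ≤ ε ≤ 1/4`, `εΛ⁴ ≤ c₁/72` (`Λ = L`): `M ≤ 9Λ⁴ − c₁/2`. [folklore] -/
theorem mean_le_of_virial {M Λ c₁ ε τ : ℝ} (hM0 : 0 ≤ M) (hε0 : 0 ≤ ε) (hε : ε ≤ 1 / 4) (hεΛ : ε * Λ ^ 4 ≤ c₁ / 72)
    (hτ : τ ≤ c₁ / 4) (h : M ≤ (18 * Λ ^ 4 - 2 * c₁ + τ) / (2 * (1 - ε))) : M ≤ 9 * Λ ^ 4 - c₁ / 2 := by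
  have h2 : 0 < 2 * (1 - ε) := by linarith
  have h1 : M * (2 * (1 - ε)) ≤ 18 * Λ ^ 4 - 2 * c₁ + τ := (le_div_iff₀ h2).1 h
  have hΛ4 : 0 ≤ Λ ^ 4 := by positivity
  -- `M ≤ 12 Λ⁴`: from `(3/2) M ≤ 2(1−ε) M ≤ 18Λ⁴ − 7c₁/4 ≤ 18 Λ⁴` … but `c₁` may be of either size relative to `Λ⁴`; use `εM ≤ 12 εΛ⁴`
  have hc₁ : 0 ≤ c₁ := by nlinarith
  have hM12 : M ≤ 12 * Λ ^ 4 := by nlinarith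
  have hεM : ε * M ≤ 12 * (ε * Λ ^ 4) := by nlinarith
  nlinarith

/-! ## §4 The reduction -/

/-- ★★★ **`PeriodicSoftness` from an Euler field near the toron valley.**  An `L`-uniform Euler field (hypothesis «EulerField», §1) implies the
deciding crux `VirialFluxGap.PeriodicSoftness` BY NAME, with softness constant `c = c₁/2` on the Laplace windows of
✓`stub_windowArithmeticZero K q 1`: the Gibbs ∕ virial pairing against the right-invariant ring measure (✓`RingIBP.ring_virial_mean_bound`),
the floor-controlled tail (`tail_le`) and the virial identity in the coupling (✓`deficitFormZero`).  No Euler field is constructed here.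
[cite: Griffiths1964] [cite: Luscher1983, §2] -/
theorem periodicSoftness_of_eulerField
    (hE : ∃ c₁ : ℝ, 0 < c₁ ∧ ∃ K : ℝ, 1 ≤ K ∧ ∃ q : ℝ, 0 ≤ q ∧ ∃ L₀ : ℕ, ∀ (L : ℕ) [NeZero L], L₀ ≤ L →
      ∃ (n : ℕ) (γ : Fin n → ℝ → (Fin (2 * L - 1 + 1) → GaugeConfig 3 L SU2) × (Site 3 L → SU2))
        (φ : Fin n → (Fin (2 * L - 1 + 1) → GaugeConfig 3 L SU2) × (Site 3 L → SU2) → ℝ)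
        (Dφ DF : Fin n → ℝ → (Fin (2 * L - 1 + 1) → GaugeConfig 3 L SU2) × (Site 3 L → SU2) → ℝ)
        (E : (Fin (2 * L - 1 + 1) → GaugeConfig 3 L SU2) × (Site 3 L → SU2) → ℝ) (ε ε₀ B : ℝ),
        (∀ j, γ j 0 = 1) ∧ (∀ j, Measurable (φ j)) ∧ (∀ j x, |φ j x| ≤ B) ∧ 0 < ε₀ ∧
        (∀ j x, ∀ t ∈ Metric.ball (0 : ℝ) ε₀, HasDerivAt (fun s => φ j (x * γ j s)) (Dφ j t x) t) ∧
        (∀ j x, ∀ t ∈ Metric.ball (0 : ℝ) ε₀,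
          HasDerivAt (fun s => ringDeficit L (fun _ => false) (x * γ j s)) (DF j t x) t) ∧
        (∀ j x, ∀ t ∈ Metric.ball (0 : ℝ) ε₀, |Dφ j t x| ≤ B) ∧ (∀ j x, ∀ t ∈ Metric.ball (0 : ℝ) ε₀, |DF j t x| ≤ B) ∧
        (∀ j, StronglyMeasurable (Dφ j 0)) ∧ (∀ j, StronglyMeasurable (DF j 0)) ∧
        Measurable E ∧ (∀ x, 0 ≤ E x) ∧ (∀ x, E x ≤ K * (L : ℝ) ^ q) ∧
        (∀ x, ringDeficit L (fun _ => false) x < (K * (L : ℝ) ^ q)⁻¹ → E x = 0) ∧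
        0 ≤ ε ∧ ε ≤ 1 / 4 ∧ ε * (L : ℝ) ^ 4 ≤ c₁ / 72 ∧
        (∀ x, 2 * (1 - ε) * ringDeficit L (fun _ => false) x - E x ≤ ∑ j, φ j x * DF j 0 x) ∧
        (∀ x, ∑ j, Dφ j 0 x ≤ 18 * (L : ℝ) ^ 4 - 2 * c₁)) :
    Summit.QuantumFields.YangMills.Theses.VirialFluxGap.PeriodicSoftness := by
  obtain ⟨c₁, hc₁, K, hK, q, hq, L₀, hfield⟩ := hE
  have hK0 : 0 < K := by linarith
  obtain ⟨a, ha, β₀, hW⟩ := stub_windowArithmeticZero K q 1 hK0 hq one_pos le_rfl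
  -- `L₁`: `log(4/c₁) ≤ L` for `L ≥ L₁`
  obtain ⟨L₁, hL₁⟩ : ∃ L₁ : ℕ, Real.log (4 / c₁) ≤ L₁ := exists_nat_ge _
  refine ⟨a, ha, c₁ / 2, by linarith, β₀, max L₀ L₁, fun β hβ L _ hL hLβ => ?_⟩
  have hL0 : L₀ ≤ L := le_trans (le_max_left _ _) hL
  have hLL₁ : L₁ ≤ L := le_trans (le_max_right _ _) hL
  have hL1 : 1 ≤ L := NeZero.one_le
  have hL1r : (1 : ℝ) ≤ L := by exact_mod_cast hL1
  -- window thresholds (with `w = 0`)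
  have hw : |(0 : ℝ)| ≤ K * (L : ℝ) ^ q := by rw [abs_zero]; positivity
  obtain ⟨hβ2, -, hthr, -⟩ := hW β hβ L hL1 hLβ 0 hw
  have hβ0 : 0 ≤ β := by linarith
  have hβpos : 0 < β := by linarith
  -- the field at this `L`
  obtain ⟨n, γ, φ, Dφ, DF, E, ε, ε₀, B, hγ, hφm, hφb, hε₀, hDφ, hDF, hDφb, hDFb, hDφm, hDFm, hEm, hE0, hEle, hEsupp,
    hε0, hε4, hεL, hXF, hdiv⟩ := hfield L hL0
  -- scales
  set T : ℝ := K * (L : ℝ) ^ q with hT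
  have hT1 : 1 ≤ T := by
    have : (1 : ℝ) ≤ (L : ℝ) ^ q := Real.one_le_rpow hL1r hq
    nlinarith
  have hT0 : 0 < T := by linarith
  have ht₁ : 0 < T⁻¹ := inv_pos.2 hT0
  have ht₁2 : T⁻¹ ≤ 2 := by rw [inv_le_comm₀ hT0 (by norm_num)]; linarith
  -- the β-explicit virial mean bound
  have hvir := ring_virial_mean_bound (L := L) (Finset.univ : Finset (Fin n)) (fun j _ => hγ j) (fun j _ => hφm j)
    (Cφ := fun _ => B) (fun j _ x => hφb j x) hε₀ (fun j _ x t ht => hDφ j x t ht) (fun j _ x t ht => hDF j x t ht)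
    (Bφ := fun _ => B) (BF := fun _ => B) (fun j _ x t ht => hDφb j x t ht) (fun j _ x t ht => hDFb j x t ht)
    (fun j _ => hDφm j) (fun j _ => hDFm j) hβ0 hEm ht₁ ht₁2 hT0.le hE0 hEle hEsupp
    (D := 18 * (L : ℝ) ^ 4 - 2 * c₁) (by linarith : ε < 1) hXF hdiv
  -- the tail
  have hlogL : Real.log (4 / c₁) ≤ (L : ℝ) ^ 8 := by
    have h8 : (L : ℝ) ≤ (L : ℝ) ^ 8 := by
      calc (L : ℝ) = (L : ℝ) ^ 1 := (pow_one _).symm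
        _ ≤ (L : ℝ) ^ 8 := pow_le_pow_right₀ hL1r (by norm_num)
    exact hL₁.trans ((Nat.cast_le.2 hLL₁).trans h8)
  have hthr' : 64 * (9 * (L : ℝ) ^ 4 - 3 / 2 + 2) ^ 2 * (1 + 2 * Real.log T + Real.log β) ≤ β * T⁻¹ := by
    have hlogT : |Real.log T⁻¹| = Real.log T := by
      rw [Real.log_inv, abs_neg, abs_of_nonneg (Real.log_nonneg hT1)]
    have h := hthr
    rw [abs_zero, hlogT] at h
    linarith
  have htail := tail_le hβ2 hT1 hL1r hc₁ hlogL hthr'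
  -- the mean bound `β⟨F₀⟩ ≤ 9L⁴ − c₁/2`
  have hZ := integral_exp_neg_mul_ringDeficit_pos (L := L) β (fun _ => false)
  have hM0 : 0 ≤ β * (∫ x, ringDeficit L (fun _ => false) x * Real.exp (-(β * ringDeficit L (fun _ => false) x)) ∂(ringMeasure L)) /
      (∫ x, Real.exp (-(β * ringDeficit L (fun _ => false) x)) ∂(ringMeasure L)) := by
    refine div_nonneg (mul_nonneg hβ0 (integral_nonneg fun x => ?_)) hZ.le
    exact mul_nonneg (ringDeficit_nonneg _ x) (Real.exp_pos _).le
  have hmean := mean_le_of_virial hM0 hε0 hε4 hεL htail hvir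
  -- convert with the virial identity in the coupling
  have hid := (deficitFormZero L).2.2 β hβpos
  rw [hid]
  linarith [hmean]

end Summit.QuantumFields.YangMills.Theorems.VirialFluxGap.EulerFieldReduction

end
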